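/-
Copyright (c) 2026 the pub-hodgecm-mathlib formalisation cell (harness21).  Prover seat hodgecm-mathlib-LH7-p04 (g12), 2026-09-03.
Road M6 → F5 (LEAD F0P3a-plan (g16) T14-66 ∕ T15-32; SIG-F5 v2 b42386c8 §6.2), brick F5-(3a) «SHIFT KIT» — F3-5 pen's glue for ★ (W1)'s `hCg′`.
-/
import Literature.NumberTheory.Automorphic.SelfDualLatticeFixOrderOnly        -- ★ (W1) p852759: `smul_map_sub_one_eq_map_shift` (the frame at the shifted pair)
import Literature.NumberTheory.Rogawski1990.EndoscopicBlockFrameBridgeInputs   -- ★ (c5-i) p853057: `isUnit_det_krylov_blockFrame` (cyclic vector of a block frame)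
import Literature.NumberTheory.Automorphic.StarPolynomialOfPair                -- ★ D′β p853212: `exists_starPoly_shift` (⋆-polynomials survive the shift)
import Literature.NumberTheory.Automorphic.ValuedFieldValuativeRelBridge       -- ★ `v_le_one_iff_mem_integer` (Valued ↔ ValuativeRel integers)
import HarnessLib

/-!
# The shift `x ↦ ϖ⁻¹(x − 1)` of a type-(2) pair: transfer of the side-condition letters of ★ (W1)

Topic `NumberTheory/Automorphic`; namespace `Literature.NumberTheory.Automorphic`.  THEOREMS ONLY (no definition, no instance, no notation, no named fact, no `sorry`).
Cell `pub/hodgecm-mathlib` (D-0151), crux H413 = `stmt-HodgeConjecture-24833`; road M6 → F5, brick **F5-(3a) «SHIFT KIT»**.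

★ (W1) `UnitaryLatticeTree.ncard_vertex_rowZero_eq_of_total` reads the residually-trivial `φ(g,u)`-stable vertices as the vertices stable under the SHIFTED pair
`(g′, u′) = (ϖ⁻¹•(g − 1), ϖ⁻¹(u − 1))` and asks for its side condition `C` only there (`hCg′`).  The F3-5 spine (★ γ p853258
`ncard_isSelfDualLattice_stable_eq_phiTHn_of_eisensteinData`) carries, besides frame letters, the PAIR letters: a root `λ` of `χ_g` in the quadratic algebra `K` with
`φ′(u, λ) = φb(g, u)`, the cyclic-vector letter `hK`, `E[x] = E × K` (`hall`), `K = E + Eλ` (`hcoordlam`), integrality, `g₁₀ ≠ 0`, `χ_g` rootless, and an integral ⋆-polynomial.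
This file moves each of them from `x = (u, λ)` to `x′ = ϖ⁻¹•(x − 1) = (u′, λ′)`, `λ′ = ι(ϖ)⁻¹(λ − 1)` — pure algebra over a field `E` and an `E`-algebra `K`:
`ϖ²·χ_{g′}(ι(ϖ)⁻¹(x − 1)) = χ_g(x)` (§1), `φ′ x′ = φb(g′, u′)`, `E[x′] = E[x]`, `E + Eλ′ = E + Eλ` (§2), integrality of the shifted pair from the depth
`|g − 1|, |u − 1| ≤ |ϖ|` of the original one (§3), and the bundle (§4, with ★ D′β `exists_starPoly_shift` and ★ (c5-i) `isUnit_det_krylov_blockFrame`).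
HONEST LABEL: count-neutral generic glue; asserts nothing printed; HC_CM is proved only modulo the 2 remaining named inputs (hLiu418 24832, h413 24833) until rung 0 closes.

## References
* [Rogawski1990] J. D. Rogawski, *Automorphic Representations of Unitary Groups in Three Variables*, Ann. of Math. Stud. 123 (1990): §4.9 p. 55 (the shift `γ ↦ ϖ⁻¹(γ − 1)` in the
  count of fixed vertices, Prop. 4.9.1 (b)).
* [Kottwitz1986BaseChangeUnits] R. E. Kottwitz, *Base change for unit elements of Hecke algebras*, Compositio Math. 60 (1986): §3 (stable lattices and the shift).
* [Jacobowitz1962] R. Jacobowitz, *Hermitian forms over local fields*, Amer. J. Math. 84 (1962): §4 (change of generator of an order).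
* [Lang2002] S. Lang, *Algebra*, 3rd ed. (2002): Ch. IV §1 (composition of polynomials), Ch. XIII §4 (trace and determinant of `2 × 2` matrices).
-/

set_option autoImplicit false

noncomputable section

open Matrix Polynomial
open scoped MatrixGroups ValuativeRel WithZero

namespace Literature.NumberTheory.Automorphic

open Literature.NumberTheory.Rogawski1990

/-! ## §1 The characteristic quadratic of the shifted block -/

section Quadratic

variable {E : Type*} [Field E] {ϖ : E}

/-- `tr (ϖ⁻¹•(g − 1)) = ϖ⁻¹(tr g − 2)` (`2 × 2`). [cite: Lang2002, Ch. XIII §4] -/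
theorem trace_shift (ϖ : E) (g : Matrix (Fin 2) (Fin 2) E) : (ϖ⁻¹ • (g - 1)).trace = ϖ⁻¹ * (g.trace - 2) := by
  rw [Matrix.trace_smul, Matrix.trace_sub, Matrix.trace_one, Fintype.card_fin, smul_eq_mul]
  norm_num

/-- `det (ϖ⁻¹•(g − 1)) = ϖ⁻²(det g − tr g + 1)` (`2 × 2`). [cite: Lang2002, Ch. XIII §4] -/
theorem det_shift (ϖ : E) (g : Matrix (Fin 2) (Fin 2) E) : (ϖ⁻¹ • (g - 1)).det = ϖ⁻¹ ^ 2 * (g.det - g.trace + 1) := by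
  rw [Matrix.det_smul, Fintype.card_fin, Matrix.det_fin_two, Matrix.det_fin_two, Matrix.trace_fin_two]
  simp only [Matrix.sub_apply, Matrix.one_apply_eq, Matrix.one_apply_ne (show (0 : Fin 2) ≠ 1 by decide),
    Matrix.one_apply_ne (show (1 : Fin 2) ≠ 0 by decide)]
  ring

/-- **`ϖ²·χ_{g′}(ϖ⁻¹(x − 1)) = χ_g(x)`** in `E`: `(ϖ⁻¹(x−1))² − tr g′·ϖ⁻¹(x−1) + det g′ = ϖ⁻²·(x² − tr g·x + det g)`, `g′ = ϖ⁻¹•(g − 1)`. [cite: Rogawski1990, §4.9 p. 55] -/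
theorem quad_shift_self (hϖ : ϖ ≠ 0) (g : Matrix (Fin 2) (Fin 2) E) (x : E) :
    ϖ⁻¹ * (x - 1) * (ϖ⁻¹ * (x - 1)) - (ϖ⁻¹ • (g - 1)).trace * (ϖ⁻¹ * (x - 1)) + (ϖ⁻¹ • (g - 1)).det =
      ϖ⁻¹ ^ 2 * (x * x - g.trace * x + g.det) := by
  rw [trace_shift, det_shift]
  field_simp
  ring

variable {K : Type*} [Field K] [Algebra E K]

/-- **`ι(ϖ)²·χ_{g′}(λ′) = χ_g(λ)`** in an `E`-algebra `K` (a field): for `λ′ = ι(ϖ)⁻¹(λ − 1)`,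
`λ′² − ι(tr g′)λ′ + ι(det g′) = ι(ϖ)⁻²·(λ² − ι(tr g)λ + ι(det g))`. [cite: Rogawski1990, §4.9 p. 55] -/
theorem quad_shift (hϖ : ϖ ≠ 0) (g : Matrix (Fin 2) (Fin 2) E) (lam : K) :
    ((algebraMap E K ϖ)⁻¹ * (lam - 1)) ^ 2 - algebraMap E K (ϖ⁻¹ • (g - 1)).trace * ((algebraMap E K ϖ)⁻¹ * (lam - 1)) +
        algebraMap E K (ϖ⁻¹ • (g - 1)).det =
      (algebraMap E K ϖ)⁻¹ ^ 2 * (lam ^ 2 - algebraMap E K g.trace * lam + algebraMap E K g.det) := by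
  have hι : algebraMap E K ϖ ≠ 0 := (_root_.map_ne_zero _).2 hϖ
  rw [trace_shift, det_shift, map_mul, map_sub, map_inv₀, map_mul, map_pow, map_inv₀, map_add, map_sub, map_one, map_ofNat]
  field_simp
  ring

/-- **THE ROOT SHIFTS**: `χ_g(λ) = 0 ⇒ χ_{g′}(λ′) = 0` (★ γ's letter `hlam` at the shifted pair). [cite: Rogawski1990, §4.9 p. 55] -/
theorem shift_root (hϖ : ϖ ≠ 0) {g : Matrix (Fin 2) (Fin 2) E} {lam : K}
    (hlam : lam ^ 2 - algebraMap E K g.trace * lam + algebraMap E K g.det = 0) :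
    ((algebraMap E K ϖ)⁻¹ * (lam - 1)) ^ 2 - algebraMap E K (ϖ⁻¹ • (g - 1)).trace * ((algebraMap E K ϖ)⁻¹ * (lam - 1)) +
        algebraMap E K (ϖ⁻¹ • (g - 1)).det = 0 := by
  rw [quad_shift hϖ, hlam, mul_zero]

/-- `χ_g(u) ≠ 0 ⇒ χ_{g′}(u′) ≠ 0`, `u′ = ϖ⁻¹(u − 1)` (★ (c5-i) `isUnit_det_krylov_blockFrame`'s `hs` at the shifted pair). [cite: Rogawski1990, §4.9 p. 55] -/
theorem shift_quad_ne_zero (hϖ : ϖ ≠ 0) {g : Matrix (Fin 2) (Fin 2) E} {u : E} (hu : u * u - g.trace * u + g.det ≠ 0) :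
    ϖ⁻¹ * (u - 1) * (ϖ⁻¹ * (u - 1)) - (ϖ⁻¹ • (g - 1)).trace * (ϖ⁻¹ * (u - 1)) + (ϖ⁻¹ • (g - 1)).det ≠ 0 := by
  rw [quad_shift_self hϖ]
  exact mul_ne_zero (pow_ne_zero _ (inv_ne_zero hϖ)) hu

/-- `χ_g` rootless in `E` ⇒ `χ_{g′}` rootless in `E` (★ γ's letter `hirr` at the shifted pair): `x = ϖ⁻¹((1 + ϖx) − 1)`. [cite: Rogawski1990, §4.9 p. 55] -/
theorem shift_rootless (hϖ : ϖ ≠ 0) {g : Matrix (Fin 2) (Fin 2) E} (hirr : ∀ x : E, x * x - g.trace * x + g.det ≠ 0) (x : E) :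
    x * x - (ϖ⁻¹ • (g - 1)).trace * x + (ϖ⁻¹ • (g - 1)).det ≠ 0 := by
  have hx : x = ϖ⁻¹ * ((1 + ϖ * x) - 1) := by rw [add_sub_cancel_left, inv_mul_cancel_left₀ hϖ]
  rw [hx]
  exact shift_quad_ne_zero hϖ (hirr _)

/-- `g₁₀ ≠ 0 ⇒ g′₁₀ = ϖ⁻¹·g₁₀ ≠ 0` (★ (c5-i)'s `h10` at the shifted pair). [cite: Rogawski1990, §4.9 p. 55] -/
theorem shift_apply_one_zero (hϖ : ϖ ≠ 0) {g : Matrix (Fin 2) (Fin 2) E} (h10 : g 1 0 ≠ 0) : (ϖ⁻¹ • (g - 1)) 1 0 ≠ 0 := by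
  rw [Matrix.smul_apply, Matrix.sub_apply, Matrix.one_apply_ne (show (1 : Fin 2) ≠ 0 by decide), sub_zero, smul_eq_mul]
  exact mul_ne_zero (inv_ne_zero hϖ) h10

end Quadratic

/-! ## §2 The frame letters at the shifted pair: `φ′ x′ = φb(g′, u′)`, `E[x′] = E[x]`, `E + Eλ′ = K` -/

section Frame

variable {E : Type*} [Field E] {K : Type*} [Field K] [Algebra E K] {ϖ : E}

/-- The shifted pair is the shift of the pair: `(ϖ⁻¹(u − 1), ι(ϖ)⁻¹(λ − 1)) = ϖ⁻¹•((u, λ) − 1)` in `E × K`. [cite: Rogawski1990, §4.9 p. 55] -/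
theorem shift_pair_eq (ϖ u : E) (lam : K) :
    ((ϖ⁻¹ * (u - 1), (algebraMap E K ϖ)⁻¹ * (lam - 1)) : E × K) = ϖ⁻¹ • (((u, lam) : E × K) - 1) :=
  Prod.ext (by simp [smul_eq_mul]) (by simp [Algebra.smul_def])

/-- `u = 1 + ϖ·u′` for `u′ = ϖ⁻¹(u − 1)` (★ D′β `exists_starPoly_shift`'s `hu`). [cite: Rogawski1990, §4.9 p. 55] -/
theorem eq_one_add_mul_shift (hϖ : ϖ ≠ 0) (u : E) : u = 1 + ϖ * (ϖ⁻¹ * (u - 1)) := by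
  rw [mul_inv_cancel_left₀ hϖ, add_sub_cancel]

/-- `λ = 1 + ι(ϖ)·λ′` for `λ′ = ι(ϖ)⁻¹(λ − 1)` (★ D′β `exists_starPoly_shift`'s `hlam`). [cite: Rogawski1990, §4.9 p. 55] -/
theorem eq_one_add_algebraMap_mul_shift (hϖ : ϖ ≠ 0) (lam : K) :
    lam = 1 + algebraMap E K ϖ * ((algebraMap E K ϖ)⁻¹ * (lam - 1)) := by
  rw [mul_inv_cancel_left₀ ((_root_.map_ne_zero _).2 hϖ), add_sub_cancel]

/-- An algebra map commutes with the shift: `φ′(ϖ⁻¹•(x − 1)) = ϖ⁻¹•(φ′ x − 1)`. [cite: Lang2002, Ch. IV §1] -/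
theorem algHom_apply_shift {A B : Type*} [Ring A] [Algebra E A] [Ring B] [Algebra E B] (φ' : A →ₐ[E] B) (ϖ : E) (x : A) :
    φ' (ϖ⁻¹ • (x - 1)) = ϖ⁻¹ • (φ' x - 1) := by
  rw [map_smul, map_sub, map_one]

/-- **THE FRAME AT THE SHIFTED PAIR**: if `φ′(u, λ) = φb(g, u)` for `E`-algebra maps `φ′ : E × K → M₃(E)`, `φb : M₂(E) × E → M₃(E)`, then `φ′(u′, λ′) = φb(g′, u′)` — ★ γ's
letter `hφx` at the shifted pair (★ (W1) `smul_map_sub_one_eq_map_shift`). [cite: Rogawski1990, §4.9 p. 55] -/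
theorem shift_frame_apply (φ' : (E × K) →ₐ[E] Matrix (Fin 3) (Fin 3) E) (φb : (Matrix (Fin 2) (Fin 2) E × E) →ₐ[E] Matrix (Fin 3) (Fin 3) E)
    (ϖ : E) {g : Matrix (Fin 2) (Fin 2) E} {u : E} {lam : K} (hφx : φ' ((u, lam) : E × K) = φb (g, u)) :
    φ' ((ϖ⁻¹ * (u - 1), (algebraMap E K ϖ)⁻¹ * (lam - 1)) : E × K) = φb (ϖ⁻¹ • (g - 1), ϖ⁻¹ * (u - 1)) := by
  rw [shift_pair_eq, algHom_apply_shift, hφx, UnitaryLatticeTree.smul_map_sub_one_eq_map_shift]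

/-- **`E[x′] = E[x]`**: if every element of an `E`-algebra `A` is a polynomial in `x`, it is a polynomial in `x′ = ϖ⁻¹•(x − 1)` (`Q ↦ Q ∘ (ϖX + 1)`) — ★ γ's letter
`hall` at the shifted pair. [cite: Lang2002, Ch. IV §1] -/
theorem shift_aeval_surjective {A : Type*} [CommRing A] [Algebra E A] (hϖ : ϖ ≠ 0) {x : A} (hall : ∀ b : A, ∃ Q : E[X], aeval x Q = b) (b : A) :
    ∃ Q : E[X], aeval (ϖ⁻¹ • (x - 1)) Q = b := by
  obtain ⟨Q, hQ⟩ := hall b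
  refine ⟨Q.comp (C ϖ * X + 1), ?_⟩
  have hx : aeval (ϖ⁻¹ • (x - 1)) (C ϖ * X + 1 : E[X]) = x := by
    rw [map_add, map_mul, aeval_C, aeval_X, map_one, ← Algebra.smul_def, smul_smul, mul_inv_cancel₀ hϖ, one_smul, sub_add_cancel]
  rw [aeval_comp, hx, hQ]

/-- **`E + E·λ′ = E + E·λ`**: `p + qλ = (p + q) + (qϖ)·λ′` — ★ γ's letter `hcoordlam` at the shifted pair. [cite: Lang2002, Ch. IV §1] -/
theorem shift_coord (hϖ : ϖ ≠ 0) {lam : K} (hcoordlam : ∀ z : K, ∃ p q : E, z = algebraMap E K p + algebraMap E K q * lam) (z : K) :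
    ∃ p q : E, z = algebraMap E K p + algebraMap E K q * ((algebraMap E K ϖ)⁻¹ * (lam - 1)) := by
  obtain ⟨p, q, rfl⟩ := hcoordlam z
  refine ⟨p + q, q * ϖ, ?_⟩
  rw [map_add, map_mul, mul_assoc, mul_inv_cancel_left₀ ((_root_.map_ne_zero _).2 hϖ)]
  ring

end Frame

/-! ## §3 Integrality of the shifted pair from the depth of the original one -/

section Depth

variable {E : Type*} [Field E] [Valued E ℤᵐ⁰] {ϖ : E}

/-- `|y| ≤ |ϖ| ≠ 0 ⇒ |ϖ⁻¹y| ≤ 1`. [cite: SerreLocalFields1979, Ch. II §1] -/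
theorem v_inv_mul_le_one (hϖ : ϖ ≠ 0) {y : E} (hy : Valued.v y ≤ Valued.v ϖ) : Valued.v (ϖ⁻¹ * y) ≤ 1 := by
  have hvϖ : Valued.v ϖ ≠ 0 := (Valuation.ne_zero_iff _).2 hϖ
  rw [map_mul, map_inv₀]
  calc (Valued.v ϖ)⁻¹ * Valued.v y ≤ (Valued.v ϖ)⁻¹ * Valued.v ϖ := by gcongr
    _ = 1 := inv_mul_cancel₀ hvϖ

/-- **DEPTH ⇒ INTEGRAL SHIFT (scalar)**: `|u − 1| ≤ |ϖ| ⇒ ϖ⁻¹(u − 1) ∈ 𝒪_E` (the ★ G-side head's `hu1`). [cite: Rogawski1990, §4.9 p. 55] -/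
theorem shift_mem_valuedInteger (hϖ : ϖ ≠ 0) {u : E} (hu1 : Valued.v (u - 1) ≤ Valued.v ϖ) : ϖ⁻¹ * (u - 1) ∈ Valued.integer E :=
  (Valuation.mem_integer_iff _ _).2 (v_inv_mul_le_one hϖ hu1)

/-- **DEPTH ⇒ INTEGRAL SHIFT (matrix)**: `|(g − 1)ᵢⱼ| ≤ |ϖ| ⇒ (ϖ⁻¹•(g − 1))ᵢⱼ ∈ 𝒪_E` (the ★ G-side head's `hg1`). [cite: Rogawski1990, §4.9 p. 55] -/
theorem shift_entry_mem_valuedInteger (hϖ : ϖ ≠ 0) {n : ℕ} {g : Matrix (Fin n) (Fin n) E} (hg1 : ∀ i j, Valued.v ((g - 1) i j) ≤ Valued.v ϖ) (i j : Fin n) :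
    (ϖ⁻¹ • (g - 1)) i j ∈ Valued.integer E := by
  rw [Matrix.smul_apply, smul_eq_mul]
  exact (Valuation.mem_integer_iff _ _).2 (v_inv_mul_le_one hϖ (hg1 i j))

variable [ValuativeRel E] [(Valued.v : Valuation E ℤᵐ⁰).Compatible]

/-- `ValuativeRel` currency of `shift_mem_valuedInteger` (★ γ ∕ ★ D′β letters `hu`, `hu′`). [cite: Rogawski1990, §4.9 p. 55] -/
theorem shift_mem_integer (hϖ : ϖ ≠ 0) {u : E} (hu1 : Valued.v (u - 1) ≤ Valued.v ϖ) : ϖ⁻¹ * (u - 1) ∈ 𝒪[E] :=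
  (v_le_one_iff_mem_integer _).1 (v_inv_mul_le_one hϖ hu1)

/-- `ValuativeRel` currency of `shift_entry_mem_valuedInteger` (★ γ's letter `hg` at the shifted pair). [cite: Rogawski1990, §4.9 p. 55] -/
theorem shift_entry_mem_integer (hϖ : ϖ ≠ 0) {n : ℕ} {g : Matrix (Fin n) (Fin n) E} (hg1 : ∀ i j, Valued.v ((g - 1) i j) ≤ Valued.v ϖ) (i j : Fin n) :
    (ϖ⁻¹ • (g - 1)) i j ∈ 𝒪[E] := by
  rw [Matrix.smul_apply, smul_eq_mul]
  exact (v_le_one_iff_mem_integer _).1 (v_inv_mul_le_one hϖ (hg1 i j))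

end Depth

/-! ## §4 The bundle: every pair letter of ★ γ at the shifted pair -/

section Bundle

variable {E : Type*} [Field E] [Valued E ℤᵐ⁰] [ValuativeRel E] [(Valued.v : Valuation E ℤᵐ⁰).Compatible]
  {K : Type*} [Field K] [Algebra E K]

/-- **THE PAIR LETTERS OF ★ γ SURVIVE THE SHIFT.**  Frame: `⋆ = (σ, σ_K)` with `σ_K ∘ ι = ι ∘ σ`, `σ` integral, `ϖ ∈ 𝒪_E ∖ 0` `σ`-fixed; block frame `φb = c·[· ⊕ ·]·c⁻¹` (★ (O-5)),
endoscopic frame `φ′` (★ FILE B).  For a pair `(g, u)` of depth `|g − 1|, |u − 1| ≤ |ϖ|` with `g₁₀ ≠ 0`, `χ_g(u) ≠ 0`, a root `λ ∈ K` of `χ_g`, `φ′(u, λ) = φb(g, u)`,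
`E[(u, λ)] = E × K`, `K = E + Eλ` and an integral ⋆-polynomial `P(u, λ) = (σu, σ_Kλ)`, the shifted pair `(g′, u′) = (ϖ⁻¹•(g − 1), ϖ⁻¹(u − 1))` with `λ′ = ι(ϖ)⁻¹(λ − 1)` is
integral, has `g′₁₀ ≠ 0`, `χ_{g′}(λ′) = 0`, `φ′(u′, λ′) = φb(g′, u′)`, the cyclic-vector letter `hK` (★ (c5-i)), `E[(u′, λ′)] = E × K`, `K = E + Eλ′`, and an integral
⋆-polynomial (★ D′β) — i.e. ★ (W1)'s `hCg′` for the side condition «★ γ's pair letters». [cite: Rogawski1990, §4.9 Prop. 4.9.1 (b) p. 55] [cite: Kottwitz1986BaseChangeUnits, §3] -/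
theorem shift_pairLetters (σ : E →+* E) (σK : K →+* K) (hσK : ∀ x, σK (algebraMap E K x) = algebraMap E K (σ x)) (hσO : ∀ x : 𝒪[E], σ x ∈ 𝒪[E])
    {ϖ : E} (hϖ : ϖ ≠ 0) (hϖO : ϖ ∈ 𝒪[E]) (hσϖ : σ ϖ = ϖ)
    (c : GL (Fin 3) E) (φb : (Matrix (Fin 2) (Fin 2) E × E) →ₐ[E] Matrix (Fin 3) (Fin 3) E)
    (hφb : ∀ (g : Matrix (Fin 2) (Fin 2) E) (u : E),
      φb (g, u) = (c : Matrix (Fin 3) (Fin 3) E) * Matrix.reindex endoPerm endoPerm (Matrix.fromBlocks g 0 0 (u • (1 : Matrix (Fin 1) (Fin 1) E))) *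
        ((c⁻¹ : GL (Fin 3) E) : Matrix (Fin 3) (Fin 3) E))
    (φ' : (E × K) →ₐ[E] Matrix (Fin 3) (Fin 3) E)
    {g : Matrix (Fin 2) (Fin 2) E} {u : E} {lam : K}
    (hg1 : ∀ i j, Valued.v ((g - 1) i j) ≤ Valued.v ϖ) (hu1 : Valued.v (u - 1) ≤ Valued.v ϖ) (h10 : g 1 0 ≠ 0) (hχu : u * u - g.trace * u + g.det ≠ 0)
    (hlam : lam ^ 2 - algebraMap E K g.trace * lam + algebraMap E K g.det = 0) (hφx : φ' ((u, lam) : E × K) = φb (g, u))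
    (hall : ∀ b : E × K, ∃ Q : E[X], aeval ((u, lam) : E × K) Q = b) (hcoordlam : ∀ z : K, ∃ p q : E, z = algebraMap E K p + algebraMap E K q * lam)
    {P : E[X]} (hP : ∀ i, P.coeff i ∈ 𝒪[E]) (hPx : aeval ((u, lam) : E × K) P = (σ u, σK lam)) :
    (∀ i j, (ϖ⁻¹ • (g - 1)) i j ∈ 𝒪[E]) ∧ ϖ⁻¹ * (u - 1) ∈ 𝒪[E] ∧ (ϖ⁻¹ • (g - 1)) 1 0 ≠ 0 ∧
      ((algebraMap E K ϖ)⁻¹ * (lam - 1)) ^ 2 - algebraMap E K (ϖ⁻¹ • (g - 1)).trace * ((algebraMap E K ϖ)⁻¹ * (lam - 1)) +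
          algebraMap E K (ϖ⁻¹ • (g - 1)).det = 0 ∧
      φ' ((ϖ⁻¹ * (u - 1), (algebraMap E K ϖ)⁻¹ * (lam - 1)) : E × K) = φb (ϖ⁻¹ • (g - 1), ϖ⁻¹ * (u - 1)) ∧
      IsUnit (Matrix.of fun i j : Fin 3 => (((φb (ϖ⁻¹ • (g - 1), ϖ⁻¹ * (u - 1))) ^ (j : ℕ)) *ᵥ
        ((c : Matrix (Fin 3) (Fin 3) E) *ᵥ (Pi.single (endoPerm (Sum.inl 0)) (1 : E) + Pi.single (endoPerm (Sum.inr 0)) (1 : E)))) i).det ∧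
      (∀ b : E × K, ∃ Q : E[X], aeval ((ϖ⁻¹ * (u - 1), (algebraMap E K ϖ)⁻¹ * (lam - 1)) : E × K) Q = b) ∧
      (∀ z : K, ∃ p q : E, z = algebraMap E K p + algebraMap E K q * ((algebraMap E K ϖ)⁻¹ * (lam - 1))) ∧
      ∃ P' : E[X], (∀ i, P'.coeff i ∈ 𝒪[E]) ∧
        aeval ((ϖ⁻¹ * (u - 1), (algebraMap E K ϖ)⁻¹ * (lam - 1)) : E × K) P' = (σ (ϖ⁻¹ * (u - 1)), σK ((algebraMap E K ϖ)⁻¹ * (lam - 1))) := by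
  have hK' := isUnit_det_krylov_blockFrame c φb hφb (ϖ⁻¹ • (g - 1)) (ϖ⁻¹ * (u - 1)) (shift_apply_one_zero hϖ h10) (shift_quad_ne_zero hϖ hχu)
  have hall' : ∀ b : E × K, ∃ Q : E[X], aeval ((ϖ⁻¹ * (u - 1), (algebraMap E K ϖ)⁻¹ * (lam - 1)) : E × K) Q = b := by
    rw [shift_pair_eq]
    exact shift_aeval_surjective hϖ hall
  have hP' := exists_starPoly_shift σ σK hσK hσO hϖ hϖO hσϖ (shift_mem_integer hϖ hu1) (eq_one_add_mul_shift hϖ u)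
    (eq_one_add_algebraMap_mul_shift hϖ lam) hP hPx
  exact ⟨shift_entry_mem_integer hϖ hg1, shift_mem_integer hϖ hu1, shift_apply_one_zero hϖ h10, shift_root hϖ hlam, shift_frame_apply φ' φb ϖ hφx,
    hK', hall', shift_coord hϖ hcoordlam, hP'⟩

end Bundle

end Literature.NumberTheory.Automorphic

/-! ## §5 ★ (W1)'s ROW 0 in `ℚ`-currency (ED. 2): the count function may be `ℚ`-valued, as ★ γ delivers it -/

section RowZeroRat

namespace Literature.NumberTheory.Automorphic.UnitaryLatticeTree

open Literature.NumberTheory.Automorphic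

variable {K : Type*} [Field K] [Valued K ℤᵐ⁰] {N : ℕ}

/-- **ROW 0 = TOTAL AT THE SHIFTED INVARIANTS, `ℚ`-CURRENCY** — ★ (W1) `ncard_vertex_rowZero_eq_of_total` for a TOT-Λ-shaped hypothesis whose count function is
`ℚ`-valued (`G n′ N′`, e.g. ★ F3-4's `phiTHn q ∕ phiTHprimen q` as delivered by ★ γ `ncard_isSelfDualLattice_stable_eq_phiTHn_of_eisensteinData`): the residually
trivial `φ(g,u)`-stable vertices of type `d` number `G (n − 2) (N − 1)` in `ℚ`.  Same proof as ★ (W1) (§2 shift + §3 Eisenstein data of the shifted pair); spares F5 the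
`ℕ`-valued `F` of ★ (W1). [cite: Rogawski1990, §4.9 p. 55] [cite: Kottwitz1986, §3] [cite: Jacobowitz1962, §7] -/
theorem cast_ncard_vertex_rowZero_eq_of_total (σ : K →+* K) {ϖ : K} (hϖ0 : ϖ ≠ 0) (hϖ1 : Valued.v ϖ ≤ 1) (H : Matrix (Fin N) (Fin N) K) (d : ℕ)
    (φ : (Matrix (Fin 2) (Fin 2) K × K) →ₐ[K] Matrix (Fin N) (Fin N) K) (C : Matrix (Fin 2) (Fin 2) K → K → Prop) (G : ℕ → ℕ → ℚ)
    (hT : ∀ (g Θ : Matrix (Fin 2) (Fin 2) K) (u α β a b : K) (n' N' : ℕ), C g u → Θ = α • 1 + β • g → Valued.v Θ.det = Valued.v ϖ → Valued.v Θ.trace < 1 →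
      u • 1 - g = a • 1 + b • Θ → Valued.v (u • 1 - g).det = Valued.v ϖ ^ n' → Valued.v b = Valued.v ϖ ^ N' →
      (({M : Submodule (Valued.integer K) (Fin N → K) | IsVertexLattice σ ϖ H d M ∧ M.map ((Matrix.toLin' (φ (g, u))).restrictScalars (Valued.integer K)) ≤ M}.ncard : ℕ) : ℚ) = G n' N')
    {g Θ : Matrix (Fin 2) (Fin 2) K} {u α β a b : K} {n M₀ : ℕ} (hCg' : C (ϖ⁻¹ • (g - 1)) (ϖ⁻¹ * (u - 1))) (hΘ : Θ = α • 1 + β • g) (hΘd : Valued.v Θ.det = Valued.v ϖ)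
    (hΘt : Valued.v Θ.trace < 1) (hrel : u • 1 - g = a • 1 + b • Θ) (hn : Valued.v (u • 1 - g).det = Valued.v ϖ ^ n) (hb : Valued.v b = Valued.v ϖ ^ M₀)
    (hn2 : 2 ≤ n) (hN1 : 1 ≤ M₀) :
    (({M : Submodule (Valued.integer K) (Fin N → K) | IsVertexLattice σ ϖ H d M ∧ M.map ((Matrix.toLin' (φ (g, u))).restrictScalars (Valued.integer K)) ≤ M ∧
        M.map ((Matrix.toLin' (φ (g, u) - 1)).restrictScalars (Valued.integer K)) ≤ scaleLattice ϖ M}.ncard : ℕ) : ℚ) = G (n - 2) (M₀ - 1) := by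
  rw [ncard_vertex_map_le_and_level_eq σ ϖ H d hϖ0 hϖ1 (φ (g, u)), smul_map_sub_one_eq_map_shift φ ϖ g u]
  exact hT (ϖ⁻¹ • (g - 1)) Θ (ϖ⁻¹ * (u - 1)) (α + β) (β * ϖ) (ϖ⁻¹ * a) (ϖ⁻¹ * b) (n - 2) (M₀ - 1) hCg'
    (theta_eq_smul_one_add_smul_shift hϖ0 hΘ) hΘd hΘt (shift_smul_one_sub_shift_eq hrel)
    (by rw [det_shift_smul_one_sub_shift, v_inv_pow_two_mul_eq hϖ0 hn2 hn]) (v_inv_mul_eq hϖ0 hN1 hb)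

/-- `ℚ`-currency of ★ (W1) `ncard_vertex_rowZero_eq_of_total_of_shiftInvariant` (globally shift-invariant side condition `C`, assumed at the original pair).
[cite: Rogawski1990, §4.9 p. 55] [cite: Kottwitz1986, §3] -/
theorem cast_ncard_vertex_rowZero_eq_of_total_of_shiftInvariant (σ : K →+* K) {ϖ : K} (hϖ0 : ϖ ≠ 0) (hϖ1 : Valued.v ϖ ≤ 1) (H : Matrix (Fin N) (Fin N) K) (d : ℕ)
    (φ : (Matrix (Fin 2) (Fin 2) K × K) →ₐ[K] Matrix (Fin N) (Fin N) K) (C : Matrix (Fin 2) (Fin 2) K → K → Prop)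
    (hC : ∀ (g : Matrix (Fin 2) (Fin 2) K) (u : K), C g u → C (ϖ⁻¹ • (g - 1)) (ϖ⁻¹ * (u - 1))) (G : ℕ → ℕ → ℚ)
    (hT : ∀ (g Θ : Matrix (Fin 2) (Fin 2) K) (u α β a b : K) (n' N' : ℕ), C g u → Θ = α • 1 + β • g → Valued.v Θ.det = Valued.v ϖ → Valued.v Θ.trace < 1 →
      u • 1 - g = a • 1 + b • Θ → Valued.v (u • 1 - g).det = Valued.v ϖ ^ n' → Valued.v b = Valued.v ϖ ^ N' →
      (({M : Submodule (Valued.integer K) (Fin N → K) | IsVertexLattice σ ϖ H d M ∧ M.map ((Matrix.toLin' (φ (g, u))).restrictScalars (Valued.integer K)) ≤ M}.ncard : ℕ) : ℚ) = G n' N')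
    {g Θ : Matrix (Fin 2) (Fin 2) K} {u α β a b : K} {n M₀ : ℕ} (hCg : C g u) (hΘ : Θ = α • 1 + β • g) (hΘd : Valued.v Θ.det = Valued.v ϖ)
    (hΘt : Valued.v Θ.trace < 1) (hrel : u • 1 - g = a • 1 + b • Θ) (hn : Valued.v (u • 1 - g).det = Valued.v ϖ ^ n) (hb : Valued.v b = Valued.v ϖ ^ M₀)
    (hn2 : 2 ≤ n) (hN1 : 1 ≤ M₀) :
    (({M : Submodule (Valued.integer K) (Fin N → K) | IsVertexLattice σ ϖ H d M ∧ M.map ((Matrix.toLin' (φ (g, u))).restrictScalars (Valued.integer K)) ≤ M ∧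
        M.map ((Matrix.toLin' (φ (g, u) - 1)).restrictScalars (Valued.integer K)) ≤ scaleLattice ϖ M}.ncard : ℕ) : ℚ) = G (n - 2) (M₀ - 1) :=
  cast_ncard_vertex_rowZero_eq_of_total σ hϖ0 hϖ1 H d φ C G hT (hC g u hCg) hΘ hΘd hΘt hrel hn hb hn2 hN1

end Literature.NumberTheory.Automorphic.UnitaryLatticeTree

end RowZeroRat

end
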